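import Mathlib
import Literature.MathematicalPhysics.KineticTheory.HardSphereEuler
import Literature.Analysis.FluidPDE.HardSphereCollisionRecord
import Literature.Analysis.UnboundedOperators.LinearizedBoltzmann
import Summits.AtomisticToContinuum.HydrodynamicLimit.Theses.TwoClocks

/-!
# Sketch — crux-ideate stmt-AtomisticToContinuum-14440 (EquilibriumFastWindowLD), ideator 2

First lemmas of the two idea cards `static-seed-doubling-rg` and `boltzmann-inverse-chaos-defect`,
stated over existing declarations. Nothing here is a route item; `sorry` only inside the two
"first lemma" theorems whose proofs are the first work of the corresponding lines.
-/

noncomputable section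

open MeasureTheory
open scoped ENNReal

namespace Summit.AtomisticToContinuum.HydrodynamicLimit.Cruxes.EquilibriumFastWindowLD.IdeatorTwo

open Literature.MathematicalPhysics.KineticTheory
open Literature.Analysis.FluidPDE

/-- Kinetic time unit `t_N = (N+1)^{-1/3}` (one unit ≍ `1/(πσ²√θ₀)` mean free times). -/
def tN (N : ℕ) : ℝ := ((N : ℝ) + 1) ^ (-(1 / 3 : ℝ))

/-- The window exponential moment of the crux at tilt `β` and window `τ` kinetic units:
`M_N(β, τ) = ∫ exp(β Σ_i w⁻¹ ∫₀^w F((Φ.flow r z)_i) dr) dG_N`, `w = τ t_N`,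
`G_N = localGibbsLaw σ a₀ u₀ θ₀` (constant profiles: the flow-invariant canonical Gibbs law). -/
def windowMGF (σ a₀ θ₀ : ℝ) (u₀ : V3) (F : T3 × V3 → ℝ) (N : ℕ)
    (Φ : HardSphereFlow (Torus.geometry (Fin 3)) (hsDiameter σ N) (N + 1)) (β τ : ℝ) : ℝ≥0∞ :=
  ∫⁻ z, ENNReal.ofReal (Real.exp (β * ∑ i : Fin (N + 1),
      (τ * tN N)⁻¹ * ∫ r in (0 : ℝ)..(τ * tN N), F ((Φ.flow r z) i)))
    ∂(localGibbsLaw σ (fun _ => a₀) (fun _ => u₀) (fun _ => θ₀) N Φ)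

/-- The conclusion of the crux for FIXED data `(σ, a₀, θ₀, u₀, Φ, F)` and a given tilt range `β₀`:
`∀ |β| ≤ β₀ ∀ ε > 0 ∃ τ > 0 ∃ N₀ ∀ N ≥ N₀, M_N(β, τ) ≤ exp(ε (N+1))`. -/
def WindowDecay (σ a₀ θ₀ : ℝ) (u₀ : V3) (F : T3 × V3 → ℝ)
    (Φ : (N : ℕ) → HardSphereFlow (Torus.geometry (Fin 3)) (hsDiameter σ N) (N + 1)) (β₀ : ℝ) :
    Prop :=
  ∀ β : ℝ, |β| ≤ β₀ → ∀ ε : ℝ, 0 < ε → ∃ τ : ℝ, 0 < τ ∧ ∃ N₀ : ℕ, ∀ N : ℕ, N₀ ≤ N →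
    windowMGF σ a₀ θ₀ u₀ F N (Φ N) β τ ≤ ENNReal.ofReal (Real.exp (ε * ((N : ℝ) + 1)))

/-! ## Card `static-seed-doubling-rg` -/

/-- STATIC SEED: the exact static bound `M_N(β, τ) ≤ exp(C β² (N+1))` for `|β| ≤ β₀`, every window
and every `N` (Jensen in time + flow-invariance of `G_N` + the one-body Maxwellian log-mgf of `F`,
which is `≤ C β²` because `∫ F M = 0` at every `x` and `|F| ≤ C_F(1+|v|²)`). -/
def StaticSeed (σ a₀ θ₀ : ℝ) (u₀ : V3) (F : T3 × V3 → ℝ)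
    (Φ : (N : ℕ) → HardSphereFlow (Torus.geometry (Fin 3)) (hsDiameter σ N) (N + 1)) (β₀ C : ℝ) :
    Prop :=
  ∀ β : ℝ, |β| ≤ β₀ → ∀ τ : ℝ, 0 < τ → ∀ N : ℕ,
    windowMGF σ a₀ θ₀ u₀ F N (Φ N) β τ ≤ ENNReal.ofReal (Real.exp (C * β ^ 2 * ((N : ℝ) + 1)))

/-- DOUBLING INEQUALITY at scale `τ` with multiplicative defect `η`:
`M_N(β, 2τ) ≤ e^{δ(N+1)} · M_N(β/2, τ)^{2(1+η)}` eventually in `N`, for all `|β| ≤ β₀` and every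
slack `δ > 0`. Cauchy–Schwarz + invariance give only the monotonicity `M_N(β,2τ) ≤ M_N(β,τ)`; `η = 0`
is exact independence of the two half-windows; in pressure terms
`Λ_{2τ}(β) ≤ 2(1+η) Λ_τ(β/2)`, equivalently near-additivity in time of the space-time pressure
`p(λ, 2τ) ≤ 2(1+η) p(λ, τ)` at the fixed small tilt-per-kinetic-time `λ = β/(2τ)`. -/
def DoublingDefect (σ a₀ θ₀ : ℝ) (u₀ : V3) (F : T3 × V3 → ℝ)
    (Φ : (N : ℕ) → HardSphereFlow (Torus.geometry (Fin 3)) (hsDiameter σ N) (N + 1))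
    (β₀ τ η : ℝ) : Prop :=
  ∀ β : ℝ, |β| ≤ β₀ → ∀ δ : ℝ, 0 < δ → ∃ N₀ : ℕ, ∀ N : ℕ, N₀ ≤ N →
    windowMGF σ a₀ θ₀ u₀ F N (Φ N) β (2 * τ) ≤
      ENNReal.ofReal (Real.exp (δ * ((N : ℝ) + 1))) *
        (windowMGF σ a₀ θ₀ u₀ F N (Φ N) (β / 2) τ) ^ (2 * (1 + η))

/-- FIRST LEMMA of the line (pure bookkeeping, provable now): a static seed plus doubling defects
that are SUMMABLE along the dyadic scales `2^j τ₀` (any `τ₀ > 0`; the seed holds at every scale) give the crux's conclusion for this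
datum, with the bonus rate `Λ_τ(β) ≲ e^{Σ η} C β² τ₀/τ`. (Iterate
`Λ_{2^k τ₀}(β) ≤ 2^k Π_{j<k}(1+η_j) Λ_{τ₀}(β 2^{-k}) ≤ e^{Σ_j η_j} C β² 2^{-k}`; the slack `δ`'s are
chosen summable.) -/
theorem windowDecay_of_summable_doubling {σ a₀ θ₀ : ℝ} {u₀ : V3} {F : T3 × V3 → ℝ}
    {Φ : (N : ℕ) → HardSphereFlow (Torus.geometry (Fin 3)) (hsDiameter σ N) (N + 1)}
    {β₀ C τ₀ : ℝ} (hβ₀ : 0 < β₀) (hC : 0 ≤ C) (hτ₀ : 0 < τ₀)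
    (η : ℕ → ℝ) (hη : ∀ j, 0 ≤ η j) (hsum : Summable η)
    (hseed : StaticSeed σ a₀ θ₀ u₀ F Φ β₀ C)
    (hdbl : ∀ j : ℕ, DoublingDefect σ a₀ θ₀ u₀ F Φ β₀ (2 ^ j * τ₀) (η j)) :
    WindowDecay σ a₀ θ₀ u₀ F Φ β₀ := by
  sorry

/-! ## Card `boltzmann-inverse-chaos-defect` -/

open Literature.Analysis.UnboundedOperators

/-- `Δh(v, w, ω) = h(v') + h(w') − h(v) − h(w)` for the hard-sphere scattering `collide ω`. -/
def collisionIncrement (h : V3 → ℝ) (ω : Metric.sphere (0 : V3) 1) (v w : V3) : ℝ :=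
  h (collide ω (v, w)).1 + h (collide ω (v, w)).2 - h v - h w

/-- The pair kernel `q_h(v, w) = ∫_{S²} ((v − w)·ω)_+ Δh(v, w, ω) dω`: the Boltzmann rate of
change of `h(v) + h(w)` for a pair with uniformly distributed relative position (per unit `ε²`).
By definition of `hardSphereLinearizedOp`, `(L h)(v) = ∫ q_h(v, w) M(dw)`. -/
def pairKernel (h : V3 → ℝ) (v w : V3) : ℝ :=
  ∫ ω, hardSphereKernel (v, w) ω * collisionIncrement h ω v w ∂sphereMeasure

/-- The EMPIRICAL CHAOTIC RATE of `H = Σ_i h(v_i)` at velocities `v`: `R_h(v) = ½ Σ_{i≠j} q_h(v_i, v_j)`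
(the molecular-chaos / Boltzmann prediction of the collisional rate of change of `H`, per unit
`ε² χ`, computed from the instantaneous velocities alone). -/
def chaoticRate (h : V3 → ℝ) {n : ℕ} (v : Fin n → V3) : ℝ :=
  (1 / 2) * ∑ i, ∑ j, if i = j then 0 else pairKernel h (v i) (v j)

/-- ALGEBRA (holds for any `h, F`): `(n−1) Σ_i F(v_i) = R_h(v) − ½ Σ_{i≠j} q̃(v_i, v_j)` with the
subtracted kernel `q̃(v, w) = q_h(v, w) − F(v) − F(w)`. The content of the line is that `q̃` is
DOUBLY CENTRED under the Maxwellian exactly when `L h = F` (next lemma), so that the second term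
is a degenerate (mode-coupling) quadratic form in the empirical fluctuation `f − M`. -/
theorem sum_eq_chaoticRate_sub_quadratic (h F : V3 → ℝ) {n : ℕ} (v : Fin n → V3) :
    ((n : ℝ) - 1) * ∑ i, F (v i) =
      chaoticRate h v -
        (1 / 2) * ∑ i, ∑ j, if i = j then 0 else (pairKernel h (v i) (v j) - F (v i) - F (v j)) := by
  sorry

/-- FIRST LEMMA (provable now): if `h` solves the linearised Boltzmann equation `L h = F` — which
has a solution of temperate growth iff `F ⊥ {1, v, |v|²}` in `L²(M)` (tree facts
`hardSphereLinearizedOp_eq_zero_iff`, `le_neg_maxwellianInner_hardSphereLinearizedOp_of_orthogonal`,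
i.e. the spectral gap; `M = stdGaussian V3` is the frame `θ₀ = 1, u₀ = 0`) — then the subtracted
pair kernel is centred in its second variable: `∫ (q_h(v, w) − F(v) − F(w)) M(dw) = 0` for every
`v`. (Symmetrically in the first variable, by `q_h(v, w) = q_h(w, v)`.) -/
theorem pairKernel_sub_centred (h F : V3 → ℝ) (hL : hardSphereLinearizedOp h = F)
    (hF1 : ∫ w, F w ∂(ProbabilityTheory.stdGaussian V3) = 0)
    (hFi : Integrable F (ProbabilityTheory.stdGaussian V3))
    (hq : ∀ v, Integrable (fun w => pairKernel h v w) (ProbabilityTheory.stdGaussian V3)) (v : V3) :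
    ∫ w, (pairKernel h v w - F v - F w) ∂(ProbabilityTheory.stdGaussian V3) = 0 := by
  sorry

/-- Enskog's contact factor `χ(η) = (Z(η) − 1) / ((2π/3) η)` from the tree's compressibility
factor (`χ → 1` as `η → 0`; junk at `η = 0`). -/
def enskogChi (η : ℝ) : ℝ := (hsCompressibility η - 1) / (2 * Real.pi / 3 * η)

/-- The CHAOS DEFECT of `H = Σ_i h(v_i)` over the window `(0, w]` along the orbit of `z`: the actual
collisional increments of `H` (a `collisionSum` over ORDERED contact pairs, hence the factor `½`)
minus the Boltzmann–Enskog rate prediction `ε_N² χ(σ³) ∫₀^w R_h(v(r)) dr` computed from the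
instantaneous velocities. For a stochastic (Kac / Lambertian) gas this is a martingale; under
the deterministic flow from `G_N` it has mean `O(1)` (detailed balance at contacts, any density). -/
def chaosDefect (σ : ℝ) (h : V3 → ℝ) (N : ℕ)
    (Φ : HardSphereFlow (Torus.geometry (Fin 3)) (hsDiameter σ N) (N + 1)) (w : ℝ)
    (z : Config (N + 1) (Fin 3) T3) : ℝ :=
  Φ.collisionSum (Set.Ioc 0 w)
      (fun c => (h c.postVel.1 + h c.postVel.2 - h c.preVel.1 - h c.preVel.2) / 2) z
    - (hsDiameter σ N) ^ 2 * enskogChi (σ ^ 3) *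
        ∫ r in (0 : ℝ)..w, chaoticRate h (fun i => ((Φ.flow r z) i).2)

/-- TRANSFER TARGET `C⁺` (the line's one dynamical stub): MARTINGALE-SIZE exponential moments of the
equilibrium chaos defect — `(N+1)⁻¹ log ∫ exp(θ · D_h(τ t_N)) dG_N ≤ C θ² σ² τ` for `|θ| ≤ θ₁`,
`τ ≥ 1`, eventually in `N` (frame `θ₀ = 1, u₀ = 0`; `σ² τ` = number of collisions per particle in
the window up to constants). Only the corner `θ = 2β/(χ σ² τ) → 0` is consumed by the crux. -/
def ChaosDefectMartingaleBound (σ a₀ : ℝ) (h : V3 → ℝ)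
    (Φ : (N : ℕ) → HardSphereFlow (Torus.geometry (Fin 3)) (hsDiameter σ N) (N + 1)) : Prop :=
  ∃ θ₁ C : ℝ, 0 < θ₁ ∧ ∀ θ : ℝ, |θ| ≤ θ₁ → ∀ τ : ℝ, 1 ≤ τ → ∃ N₀ : ℕ, ∀ N : ℕ, N₀ ≤ N →
    ∫⁻ z, ENNReal.ofReal (Real.exp (θ * chaosDefect σ h N (Φ N) (τ * tN N) z))
        ∂(localGibbsLaw σ (fun _ => a₀) (fun _ => (0 : V3)) (fun _ => (1 : ℝ)) N (Φ N)) ≤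
      ENNReal.ofReal (Real.exp (C * θ ^ 2 * σ ^ 2 * τ * ((N : ℝ) + 1)))

/-- COMPOSITION SHAPE of the line (to be the `_of` theorem of a crux-plan skeleton): for a bounded
velocity observable `F ⊥` invariants with `L h = F`, the martingale bound for `D_h` gives the
window decay for `F` in the frame `(θ₀, u₀) = (1, 0)`; the three other ingredients (coboundary
`H(z_w) − H(z_0)`, the degenerate quadratic form, `x`-freezing) are static. -/
theorem windowDecay_of_chaosDefectBound {σ a₀ : ℝ} {h F : V3 → ℝ}
    {Φ : (N : ℕ) → HardSphereFlow (Torus.geometry (Fin 3)) (hsDiameter σ N) (N + 1)}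
    (hσ : 0 < σ) (ha₀ : 0 < a₀) (hL : hardSphereLinearizedOp h = F)
    (hFb : ∃ C, ∀ v, |F v| ≤ C) (hhb : ∃ C, ∀ v, |h v| ≤ C)
    (horth : ∀ φ ∈ collisionInvariants V3, maxwellianInner F φ = 0)
    (hD : ChaosDefectMartingaleBound σ a₀ h Φ) :
    ∃ β₀ : ℝ, 0 < β₀ ∧ WindowDecay σ a₀ 1 0 (fun y => F y.2) Φ β₀ := by
  sorry

/-- Sanity: the crux decl is in scope by name (type only). -/
example : Prop := Summit.AtomisticToContinuum.HydrodynamicLimit.Theses.TwoClocks.EquilibriumFastWindowLD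

end Summit.AtomisticToContinuum.HydrodynamicLimit.Cruxes.EquilibriumFastWindowLD.IdeatorTwo
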